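import Literature.Topology.FourManifolds.FishtailZoneNorth
import Literature.Topology.FourManifolds.GompfTubeShearModel
import HarnessLib

/-!
# The tube in the north cap chart, in latitude–base form

Infrastructure for the explicit fishtail neighbourhood (R. Gompf, *More Cappell–Shaneson spheres
are standard*, Algebr. Geom. Topol. 10 (2010), proof of Thm 2.1 and Lemma 2.2; the named fact
`Literature.Topology.FourManifolds.gompf2010_framedTwist`). `FishtailZoneNorth.lean` writes the
tube about Gompf's disc near the puncture as a function of the cap-chart point `d` and reads its
base coordinate as `capS d`, which is discontinuous across the slit. Here the same tube is written
as a function of the latitude `n` and a real base parameter `s` (the chart point being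
`capPt ε n s`), which is smooth for all `s` and `1`-periodic in `s` whenever the monodromy fixes
the tube point (the two-chart mechanism of `FishtailBaseCharts.lean` then handles a full turn):

* `Literature.Topology.FourManifolds.northNS … ψ (n, s, a, b) = mtPt ψ (northT3 (capPt ε n s) a b) s`;
* `Literature.Topology.FourManifolds.isLocalDiffeomorphAt_northNS` — a local diffeomorphism at
  `(n, s, a, b)` with `-ε < n < 0`, `0 < s < 3/2`, `λ ≠ 0`, where the section `σ` is smooth
  (real form: a shear over `(n, s)` followed by the exponential coordinates);
* `Literature.Topology.FourManifolds.northNS_add_one` — periodicity `[x, s + 1] = [x, s]` when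
  `ψ x = x` (`mtPt_apply_add_one`), and `tubeShear_northT3` — the tube shear fixes the tube
  points of the north chart region (`F(e^{in}) = 1` for `arg ∉ (1, 2)`).

Everything is proved; no named facts.

## References

* R. E. Gompf, *More Cappell–Shaneson spheres are standard*, Algebr. Geom. Topol. 10 (2010)
  1665–1681, proof of Thm 2.1 and Lemma 2.2. [GompfAGT2010]
-/

noncomputable section

open scoped Real ContDiff Topology Manifold
open Set Function Filter Complex

namespace Literature.Topology.FourManifolds

local notation "𝔼" n => EuclideanSpace ℝ (Fin n)
local notation "𝓣" =>
  (ModelWithCorners.prod (𝓡 1) (ModelWithCorners.prod (𝓡 1) (𝓡 1)))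

/-! ### Periodicity of the real base coordinate at fixed points of the monodromy -/

section Periodic

variable {ψ : ThreeTorus ≃ₘ⟮𝓣, 𝓣⟯ ThreeTorus}

/-- **`[x, s + 1] = [x, s]` for `ψ x = x`**, `s ∈ (0, 1/2)`. [folklore] -/
theorem mtPt_add_one_of_fix {x : ThreeTorus} (hx : ψ x = x) {s : ℝ} (h : 0 < s ∧ s < 1 / 2) :
    mtPt ψ x (s + 1) = mtPt ψ x s := by
  conv_lhs => rw [← hx]
  exact mtPt_apply_add_one x h

/-- The tube shear fixes points whose latitude `z₁ z₃` has argument `≤ 1`. [folklore] -/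
theorem tubeShear_eq_self_of_arg_le_one {z : ThreeTorus} (h : arg ((z.1 * z.2.2 : Circle) : ℂ) ≤ 1) : tubeShear z = z :=
  tubeShear_eq_self (shearF_eq_one_of_arg_le_one h)

end Periodic

/-! ### The tube in latitude–base form -/

section NS

variable (ε tj δ r₁ r₂ r₃ lam : ℝ) (ψ : ThreeTorus ≃ₘ⟮𝓣, 𝓣⟯ ThreeTorus)

/-- **The tube in the north cap chart, latitude–base form.** [folklore] -/
def northNS (q : ℝ × ℝ × ℝ × ℝ) : MTorus ψ :=
  mtPt ψ (northT3 ε tj δ r₁ r₂ r₃ lam (capPt ε q.1 q.2.1) q.2.2.1 q.2.2.2) q.2.1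

variable {ε tj δ r₁ r₂ r₃ lam ψ}

/-- The latitude of the tube point is `e^{in}`: `z₁ z₃ = e^{i capN d}`. [folklore] -/
theorem northT3_fst_mul (d : ℂ) (a b : ℝ) :
    (northT3 ε tj δ r₁ r₂ r₃ lam d a b).1 * (northT3 ε tj δ r₁ r₂ r₃ lam d a b).2.2 = Circle.exp (capN ε d) := by
  simp [northT3]

/-- **The tube shear fixes the tube points of the north chart** when `-π < capN d ≤ 1`
(always: `capN d ∈ (-ε, 0]`, `ε < π`). [folklore] -/
theorem tubeShear_northT3 (hε : 0 < ε) (hεπ : ε < π) (d : ℂ) (a b : ℝ) :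
    tubeShear (northT3 ε tj δ r₁ r₂ r₃ lam d a b) = northT3 ε tj δ r₁ r₂ r₃ lam d a b := by
  refine tubeShear_eq_self_of_arg_le_one ?_
  rw [northT3_fst_mul]
  have h1 : -π < capN ε d := by
    have := capLat_sq_lt hε ‖d‖
    rw [capN]
    nlinarith
  have h2 : capN ε d ≤ 0 := by
    rw [capN, capLat]
    have : 0 ≤ ε * ‖d‖ / Real.sqrt (1 + ‖d‖ ^ 2) := by positivity
    have e : -ε * ‖d‖ / Real.sqrt (1 + ‖d‖ ^ 2) = -(ε * ‖d‖ / Real.sqrt (1 + ‖d‖ ^ 2)) := by ring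
    linarith
  rw [Circle.arg_exp h1 (by linarith)]
  linarith

/-- **Periodicity in the base**: `northNS (n, s + 1, a, b) = northNS (n, s, a, b)` for
`s ∈ (0, 1/2)` when `ψ` fixes the tube point. [folklore] -/
theorem northNS_add_one (hψ : ∀ d a b, ψ (northT3 ε tj δ r₁ r₂ r₃ lam d a b) = northT3 ε tj δ r₁ r₂ r₃ lam d a b)
    (n : ℝ) {s : ℝ} (hs : 0 < s ∧ s < 1 / 2) (a b : ℝ) :
    northNS ε tj δ r₁ r₂ r₃ lam ψ (n, s + 1, a, b) = northNS ε tj δ r₁ r₂ r₃ lam ψ (n, s, a, b) := by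
  simp only [northNS]
  have hp : capPt ε n (s + 1) = capPt ε n s := by
    simp only [capPt]
    rw [show (2 * π * (s + 1 : ℝ) : ℂ) * I = 2 * π * s * I + 2 * π * I by push_cast; ring, Complex.exp_add,
      Complex.exp_two_pi_mul_I, mul_one]
  rw [hp]
  exact mtPt_add_one_of_fix (hψ _ _ _) hs

/-! #### The real form -/

variable (ε lam)

/-- The real form: `(n, s, a, b) ↦ ((n - ℓ, λa, ℓ), s)`, `ℓ = σ̃(capPt n s) - λb`. [folklore] -/
def northRealNS (σt : ℂ → ℝ) (q : ℝ × ℝ × ℝ × ℝ) : (𝔼 3) × ℝ :=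
  (WithLp.toLp 2 ![q.1 - (σt (capPt ε q.1 q.2.1) - lam * q.2.2.2), lam * q.2.2.1, σt (capPt ε q.1 q.2.1) - lam * q.2.2.2], q.2.1)

variable {ε lam}

/-- The reordering `(n, s, a, b) ↦ ((n, s), (a, b))`, a diffeomorphism. [folklore] -/
def nsIn : (ℝ × ℝ × ℝ × ℝ) ≃ₘ⟮𝓘(ℝ, ℝ × ℝ × ℝ × ℝ), 𝓘(ℝ, (ℝ × ℝ) × (ℝ × ℝ))⟯ ((ℝ × ℝ) × (ℝ × ℝ)) where
  toFun q := ((q.1, q.2.1), q.2.2)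
  invFun p := (p.1.1, p.1.2, p.2)
  left_inv _ := rfl
  right_inv _ := rfl
  contMDiff_toFun := contMDiff_iff_contDiff.2 ((contDiff_fst.prodMk (contDiff_fst.comp contDiff_snd)).prodMk
    (contDiff_snd.comp contDiff_snd))
  contMDiff_invFun := contMDiff_iff_contDiff.2 ((contDiff_fst.comp contDiff_fst).prodMk
    ((contDiff_snd.comp contDiff_fst).prodMk contDiff_snd))

/-- The value of `nsIn`. [folklore] -/
@[simp] theorem nsIn_apply (q : ℝ × ℝ × ℝ × ℝ) : nsIn q = ((q.1, q.2.1), q.2.2) := rfl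

/-- The real form factors through the shear and `northAssemble`. [folklore] -/
theorem northRealNS_eq (σt : ℂ → ℝ) (q : ℝ × ℝ × ℝ × ℝ) :
    northRealNS ε lam σt q = northAssemble
      ((nsIn q).1, (lam * (nsIn q).2.1, σt (capPt ε (nsIn q).1.1 (nsIn q).1.2) - lam * (nsIn q).2.2)) := by
  simp only [northRealNS, northAssemble_apply, nsIn_apply]

/-- Where the lift exponentiates to `σ` and `-ε < n ≤ 0`, the tube is the exponential of its real form. [folklore] -/
theorem northNS_eq_of_lift (hε : 0 < ε) {σt : ℂ → ℝ} {q : ℝ × ℝ × ℝ × ℝ} (hn : q.1 ^ 2 < ε ^ 2) (hn0 : q.1 ≤ 0)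
    (h : Circle.exp (σt (capPt ε q.1 q.2.1)) = sigmaCapC tj δ r₁ r₂ r₃ (capPt ε q.1 q.2.1)) :
    northNS ε tj δ r₁ r₂ r₃ lam ψ q = mtCoord ψ (northRealNS ε lam σt q) := by
  have hz : northZ3 tj δ r₁ r₂ r₃ lam (capPt ε q.1 q.2.1) q.2.2.2 = Circle.exp (σt (capPt ε q.1 q.2.1) - lam * q.2.2.2) := by
    rw [northZ3, ← h, ← Circle.exp_add, sub_eq_add_neg]
  have hN : capN ε (capPt ε q.1 q.2.1) = q.1 := capN_capPt hε hn hn0 _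
  simp only [northNS, mtCoord, northRealNS, northT3, expT, hz, hN]
  congr 1
  refine Prod.ext ?_ (Prod.ext ?_ ?_)
  · show Circle.exp q.1 * (Circle.exp (σt (capPt ε q.1 q.2.1) - lam * q.2.2.2))⁻¹ = Circle.exp _
    simp only [Matrix.cons_val_zero]
    rw [sub_eq_add_neg q.1, Circle.exp_add, Circle.exp_neg]
  · simp
  · simp

/-- **The real form is a local diffeomorphism** where `σ̃ ∘ capPt` is smooth near `(n, s)` and
`λ ≠ 0` (a shear over `(n, s)`). [folklore] -/
theorem isLocalDiffeomorphAt_northRealNS (hlam : lam ≠ 0) {σt : ℂ → ℝ} {q : ℝ × ℝ × ℝ × ℝ}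
    (hσt : ∀ᶠ p in 𝓝 (q.1, q.2.1), ContDiffAt ℝ ∞ (fun p : ℝ × ℝ ↦ σt (capPt ε p.1 p.2)) p) :
    IsLocalDiffeomorphAt 𝓘(ℝ, ℝ × ℝ × ℝ × ℝ) 𝓘(ℝ, (𝔼 3) × ℝ) ∞ (northRealNS ε lam σt) q := by
  have h1 : IsLocalDiffeomorphAt 𝓘(ℝ, ℝ × ℝ × ℝ × ℝ) 𝓘(ℝ, (ℝ × ℝ) × (ℝ × ℝ)) ∞ nsIn q := nsIn.isLocalDiffeomorph q
  obtain ⟨U, hU, hUo, hqU⟩ : ∃ U : Set (ℝ × ℝ), (∀ p ∈ U, ContDiffAt ℝ ∞ (fun p : ℝ × ℝ ↦ σt (capPt ε p.1 p.2)) p) ∧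
      IsOpen U ∧ (q.1, q.2.1) ∈ U := by
    obtain ⟨U, hU, hUo, hq⟩ := mem_nhds_iff.1 hσt
    exact ⟨U, fun p hp ↦ hU hp, hUo, hq⟩
  have h2 : IsLocalDiffeomorphAt 𝓘(ℝ, (ℝ × ℝ) × (ℝ × ℝ)) 𝓘(ℝ, (ℝ × ℝ) × (ℝ × ℝ)) ∞
      (fun p : (ℝ × ℝ) × (ℝ × ℝ) ↦ (p.1, (lam * p.2.1, σt (capPt ε p.1.1 p.1.2) - lam * p.2.2))) (nsIn q) := by
    set W : Set ((ℝ × ℝ) × (ℝ × ℝ)) := {p | p.1 ∈ U} with hW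
    have hWo : IsOpen W := hUo.preimage continuous_fst
    have hqW : nsIn q ∈ W := hqU
    have hf : ContDiffOn ℝ ∞ (fun p : (ℝ × ℝ) × (ℝ × ℝ) ↦ (lam * p.2.1, σt (capPt ε p.1.1 p.1.2) - lam * p.2.2)) W := by
      intro p hp
      have hσ' : ContDiffAt ℝ ∞ (fun p : (ℝ × ℝ) × (ℝ × ℝ) ↦ σt (capPt ε p.1.1 p.1.2)) p :=
        (hU _ hp).comp p contDiffAt_fst
      exact ((contDiffAt_const.mul (contDiffAt_fst.comp p contDiffAt_snd)).prodMk
        (hσ'.sub (contDiffAt_const.mul (contDiffAt_snd.comp p contDiffAt_snd)))).contDiffWithinAt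
    refine isLocalDiffeomorphAt_graph hWo hqW hf (by exact_mod_cast le_top)
      (pair2EquivProd (lam, 0) (0, -lam) (by simp [hlam])) ?_
    set p₀ := nsIn q with hp₀
    have hu1 : HasDerivAt (fun a : ℝ ↦ lam * a) lam p₀.2.1 := by simpa using (hasDerivAt_id p₀.2.1).const_mul lam
    have hv1 : HasDerivAt (fun b : ℝ ↦ σt (capPt ε p₀.1.1 p₀.1.2) - lam * b) (-lam) p₀.2.2 := by
      simpa using ((hasDerivAt_id p₀.2.2).const_mul lam).const_sub (σt (capPt ε p₀.1.1 p₀.1.2))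
    have hu : HasDerivAt (fun a ↦ (lam * a, σt (capPt ε p₀.1.1 p₀.1.2) - lam * p₀.2.2)) (lam, 0) p₀.2.1 :=
      hu1.prodMk (hasDerivAt_const _ _)
    have hv : HasDerivAt (fun b ↦ (lam * p₀.2.1, σt (capPt ε p₀.1.1 p₀.1.2) - lam * b)) (0, -lam) p₀.2.2 :=
      (hasDerivAt_const _ _).prodMk hv1
    have hdiff : DifferentiableAt ℝ (fun x : ℝ × ℝ ↦ (lam * x.1, σt (capPt ε p₀.1.1 p₀.1.2) - lam * x.2)) p₀.2 :=
      ((differentiableAt_const _).mul differentiableAt_fst).prodMk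
        ((differentiableAt_const _).sub ((differentiableAt_const _).mul differentiableAt_snd))
    have h := hasFDerivAt_of_partials hdiff hu hv
    rw [coe_pair2EquivProd]
    exact h
  have h3 := northAssemble.isLocalDiffeomorph
    ((nsIn q).1, (lam * (nsIn q).2.1, σt (capPt ε (nsIn q).1.1 (nsIn q).1.2) - lam * (nsIn q).2.2))
  have h := (h1.comp (K := 𝓘(ℝ, (ℝ × ℝ) × (ℝ × ℝ))) (P := (ℝ × ℝ) × (ℝ × ℝ)) h2).comp
    (K := 𝓘(ℝ, (𝔼 3) × ℝ)) (P := (𝔼 3) × ℝ) h3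
  exact isLocalDiffeomorphAt_congr_nhds' h (Eventually.of_forall fun q' ↦ northRealNS_eq σt q')

/-- `capPt` is smooth at `(n, s)` with `n² < ε²`. [folklore] -/
theorem contDiffAt_capPt' {p : ℝ × ℝ} (hn : p.1 ^ 2 < ε ^ 2) : ContDiffAt ℝ ∞ (fun p : ℝ × ℝ ↦ capPt ε p.1 p.2) p :=
  (contDiffOn_capPt ε).contDiffAt ((isOpen_lt (continuous_fst.pow 2) continuous_const).mem_nhds hn)

/-- **The tube in latitude–base form is a local diffeomorphism** at `(n, s, a, b)` with
`n² < ε²`, `n < 0`, `0 < s < 3/2`, `λ ≠ 0`, where `σ` is smooth near `capPt ε n s`. [folklore] -/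
theorem isLocalDiffeomorphAt_northNS (hε : 0 < ε) (hlam : lam ≠ 0) {q : ℝ × ℝ × ℝ × ℝ} (hn : q.1 ^ 2 < ε ^ 2)
    (hn0 : q.1 < 0) (h0 : 0 < q.2.1) (h1 : q.2.1 < 3 / 2)
    (hσ : ∀ᶠ d in 𝓝 (capPt ε q.1 q.2.1), ContMDiffAt 𝓘(ℝ, ℂ) (𝓡 1) ∞ (sigmaCapC tj δ r₁ r₂ r₃) d) :
    IsLocalDiffeomorphAt 𝓘(ℝ, ℝ × ℝ × ℝ × ℝ) 𝓘(ℝ, 𝔼 4) ∞ (northNS ε tj δ r₁ r₂ r₃ lam ψ) q := by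
  set d₁ := capPt ε q.1 q.2.1 with hd₁
  set σt := circleLift (sigmaCapC tj δ r₁ r₂ r₃) d₁ with hσt
  have hcont : ContinuousAt (sigmaCapC tj δ r₁ r₂ r₃) d₁ := hσ.self_of_nhds.continuousAt
  have hslit := eventually_mem_slitPlane hcont
  have hσt' : ∀ᶠ d in 𝓝 d₁, ContDiffAt ℝ ∞ σt d := by
    filter_upwards [hσ, hslit] with d hd hd'
    exact contDiffAt_circleLift hd hd'
  -- pull back along the smooth map `(n, s) ↦ capPt n s`
  have hcp : ContDiffAt ℝ ∞ (fun p : ℝ × ℝ ↦ capPt ε p.1 p.2) (q.1, q.2.1) := contDiffAt_capPt' hn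
  have hσtp : ∀ᶠ p in 𝓝 (q.1, q.2.1), ContDiffAt ℝ ∞ (fun p : ℝ × ℝ ↦ σt (capPt ε p.1 p.2)) p := by
    have hopen : ∀ᶠ p in 𝓝 (q.1, q.2.1), p.1 ^ 2 < ε ^ 2 :=
      (isOpen_lt (continuous_fst.pow 2) continuous_const).mem_nhds hn
    have hpre := hcp.continuousAt.preimage_mem_nhds (show {d | ContDiffAt ℝ ∞ σt d} ∈ 𝓝 (capPt ε q.1 q.2.1) from hσt')
    filter_upwards [hpre, hopen] with p hp hp'
    exact ContDiffAt.comp (g := σt) p hp (contDiffAt_capPt' hp')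
  have hR := isLocalDiffeomorphAt_northRealNS (ε := ε) hlam hσtp
  have hC : IsLocalDiffeomorphAt 𝓘(ℝ, (𝔼 3) × ℝ) 𝓘(ℝ, 𝔼 4) ∞ (mtCoord ψ) (northRealNS ε lam σt q) := by
    have h := isLocalDiffeomorphAt_mtCoord (ψ := ψ) (q := northRealNS ε lam σt q) h0 h1
    rw [← modelWithCornersSelf_prod, chartedSpaceSelf_prod] at h
    exact h
  have h := hR.comp (K := 𝓘(ℝ, 𝔼 4)) (P := MTorus ψ) hC
  -- near `q` the tube is the exponential of the real form
  have hev : northNS ε tj δ r₁ r₂ r₃ lam ψ =ᶠ[𝓝 q] fun q' ↦ mtCoord ψ (northRealNS ε lam σt q') := by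
    have hopen1 : ∀ᶠ q' in 𝓝 q, q'.1 ^ 2 < ε ^ 2 := (isOpen_lt (continuous_fst.pow 2) continuous_const).mem_nhds hn
    have hopen2 : ∀ᶠ q' in 𝓝 q, q'.1 < 0 := (isOpen_lt continuous_fst continuous_const).mem_nhds hn0
    filter_upwards [hopen1, hopen2] with q' h1' h2'
    exact northNS_eq_of_lift hε h1' h2'.le (circleExp_circleLift _ _ _)
  exact isLocalDiffeomorphAt_congr_nhds' h hev

end NS

end Literature.Topology.FourManifolds
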